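/-
Copyright (c) 2026 the pub-hodgecm-mathlib formalisation cell (harness21).  Prover seat hodgecm-mathlib-LH4-p09 (g8), req620 Track A «(D-RAM) FOUR-FRAME» squad
(heir LEAD F0P3a-plan (g20) T19-24 «STAGE-1b PRE-SCOPING BY IDLE HANDS: ALLOWED AS SCOPING»; dealer LH4-plan (g12)).  2026-09-04.
-/
import Summits.HodgeConjecture.HodgeConjecture.Theorems.F0P3cDyRamDiagonalGluedSocket   -- ★ B56 socket (LH4-p08 (g2)): `finsum_stabiliserWeight_hasAxis_G1`; brings ★ F1 `stratum_G1_eq` (the G1 normal form)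
import Summits.HodgeConjecture.HodgeConjecture.Theorems.F0P3cDyRamLabelledSplitStrata      -- ★ p859094 (this seat): `finsum_mem_sep_eq_ite_of_forall_iff`; brings ★ p859056 `latticeInLevel_diagonal_latt_hnf_pow_iff`
import HarnessLib

/-!
# Crux `H413`, line LH4 «(D-RAM) FOUR-FRAME» road — STAGE-1b SCOPING BRICK «(L-model-G1)»: THE DIAGONAL LEVEL TOKEN READ ON THE GLUED STRATUM G1 `(2ρ, 2ρ+s, 2ρ+s)`, its
# CONSTANCY OFF THE CANCELLATION LOCUS, and the labelled G1 eighth of a Stage-B table there (over ★ B56)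

Cell `hodgecm-mathlib` (D-0151), FLOOR 0, crux item H413 = `stmt-HodgeConjecture-24833`, route of record `HCCMUnconditional`; squad F0∕P3c∕LH4 (req618∕req620).
THEOREMS ONLY (no `def`, no instance, no notation, no `sorry`, default heartbeats); lane `--supports stmt-HodgeConjecture-24833 --as helper` (count-neutral).
Consumers: the producers of the labelled Stage-B tables of the STAGE-1b type-(1) level laws (★ p858861∕p858900 composites).  ★ p859094 did the four SPLIT eighths (the token is
constant there); ★ F1 `stratum_G1_eq` writes the GLUED stratum G1 as `latt[[1,0,0],[x,ϖ^ρ,0],[xζ+y″,ϖ^ρζ,ϖ^{2ρ+s}]]`, `|x| = |ζ| = 1`, `|y″| = |ϖ|^s`; this file reads a diagonal token on it.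

THE MATHEMATICS ([Serre1980Trees, II §1.1]; [Kottwitz1986BaseChangeUnits, §1]; [Rogawski1990, §4.9]).  ★ p859056 `latticeInLevel_diagonal_latt_hnf_pow_iff` at `(b, c) = (ρ, 2ρ+s)`,
`y = xζ + y″`, `z = ϖ^ρζ` gives, after cancelling `|ϖ|^ρ` and `|x| = |ζ| = 1`:
`diag(e)·M ⊆ ϖ^ℓ·M ↔ (∀ i, |e_i| ≤ |ϖ|^ℓ) ∧ |e₁ − e₀| ≤ |ϖ|^{ℓ+ρ} ∧ |e₂ − e₁| ≤ |ϖ|^{ℓ+ρ+s} ∧ |xζ·(e₂ − e₁) + (e₂ − e₀)·y″| ≤ |ϖ|^{ℓ+2ρ+s}` (§1) — the last, MIXED inequality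
is the only place the glue residues `x, ζ, y″` enter.  Its two terms have valuations `|e₂ − e₁|` and `|e₂ − e₀|·|ϖ|^s`; when these DIFFER (no cancellation) the inequality is
equivalent to `max(|e₂ − e₁|, |e₂ − e₀|·|ϖ|^s) ≤ |ϖ|^{ℓ+2ρ+s}` (§2, ultrametric equality case), so the token is CONSTANT on the stratum and the labelled G1 weight is ★ B56's value
behind that indicator (§3).  ON THE CANCELLATION LOCUS `|e₂ − e₁| = |e₂ − e₀|·|ϖ|^s` (for the operators of record `e = (α−1, β−1, 0)`: `n₁ = n₂ + s`, which is exactly ★ B56's FOOT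
regime) the token cuts the stratum by the residue of `xζ(e₂−e₁) + (e₂−e₀)y″` — that sub-stratum census is the producers' genuinely new table and is NOT computed here.
* §1 `latticeInLevel_diagonal_latt_G1_iff` (the read; generic valued field).
* §2 `v_add_le_iff_of_v_ne` (ultrametric: `|a| ≠ |b| → (|a + b| ≤ c ↔ |a| ≤ c ∧ |b| ≤ c)`), `latticeInLevel_diagonal_latt_G1_iff_of_ne` (constancy off the locus).
* §3 HEAD `finsum_stabiliserWeight_stratum_G1_sep_latticeInLevel_of_ne` (the labelled G1 eighth off the cancellation locus, over ★ `finsum_stabiliserWeight_hasAxis_G1`).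
HONEST LABEL.  Count-neutral (`--supports`); nothing printed is asserted; pays NO tier-0 row; the foot∕cancellation sub-census, G2∕G3 (★ §P transport) and H remain PROVER TARGETS;
`HC_CM` is proved only modulo the 7 printed citations (2 remaining named inputs: hLiu418 = `stmt-HodgeConjecture-24832`, h413 = `stmt-HodgeConjecture-24833`) until rung 0 closes.

## References
* [Serre1980Trees] J.-P. Serre, *Trees*, Springer (1980), Ch. II §1.1 (lattices, Hermite normal forms).
* [Kottwitz1986BaseChangeUnits] R. E. Kottwitz, *Base change for unit elements of Hecke algebras*, Compositio Math. 60 (1986), §1 pp. 240–241 (lattice counts modulo the torus).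
* [Rogawski1990] J. D. Rogawski, *Automorphic Representations of Unitary Groups in Three Variables*, Ann. of Math. Stud. 123 (1990), §4.9 Prop. 4.9.1 (a)(b) p. 55.
-/

set_option autoImplicit false

noncomputable section

namespace Summit.HodgeConjecture.HodgeConjecture.Cruxes.H413.F0P3cDyRamLabelledGluedStratumRead

open Literature.NumberTheory.Automorphic Literature.NumberTheory.Automorphic.HermitianLattice
open Literature.NumberTheory.Automorphic.UnitaryLatticeTree Literature.NumberTheory.Automorphic.UnitaryThreeFourFrame
open Summit.HodgeConjecture.HodgeConjecture.Cruxes.H413.F0P3cDyRamDiagonalTorusDefs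
open Summit.HodgeConjecture.HodgeConjecture.Cruxes.H413.F0P3cDyRamDiagonalStrataDefs
open Summit.HodgeConjecture.HodgeConjecture.Cruxes.H413.F0P3cDyRamDiagonalGluedStratum
open Summit.HodgeConjecture.HodgeConjecture.Cruxes.H413.F0P3cDyRamDiagonalGluedSocket
open Summit.HodgeConjecture.HodgeConjecture.Cruxes.H413.F0P3cDyRamFourFrameCensusDefs
open Summit.HodgeConjecture.HodgeConjecture.Cruxes.H413.F0P3cDyRamLevelTokenHNF
open Summit.HodgeConjecture.HodgeConjecture.Cruxes.H413.F0P3cDyRamLabelledSplitStrata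
open scoped Valued WithZero Matrix MatrixGroups

/-! ## §1  The token read on the G1 normal form -/

section Read

variable {K : Type*} [Field K] [Valued K ℤᵐ⁰]

/-- **THE DIAGONAL LEVEL TOKEN ON THE GLUED NORMAL FORM G1** `latt[[1,0,0],[x,ϖ^ρ,0],[xζ+y″,ϖ^ρζ,ϖ^{2ρ+s}]]` (`|x| = |ζ| = 1`; `y″` arbitrary here):
`diag(e)·M ⊆ ϖ^ℓ·M ↔ (∀ i, |e_i| ≤ |ϖ|^ℓ) ∧ |e₁ − e₀| ≤ |ϖ|^{ℓ+ρ} ∧ |e₂ − e₁| ≤ |ϖ|^{ℓ+ρ+s} ∧ |x·ζ·(e₂ − e₁) + (e₂ − e₀)·y″| ≤ |ϖ|^{ℓ+2ρ+s}` (★ p859056 at `(b, c) = (ρ, 2ρ+s)`,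
the common factor `ϖ^ρ` of the mixed term cancelled). [cite: Serre1980Trees, II §1.1] [cite: Kottwitz1986BaseChangeUnits, §1 pp. 240–241] -/
theorem latticeInLevel_diagonal_latt_G1_iff {ϖ : K} (hϖ : ϖ ≠ 0) (ℓ ρ s : ℕ) (e : Fin 3 → K) {x ζ : K} (hx : Valued.v x = 1) (hζ : Valued.v ζ = 1) (y'' : K) :
    LatticeInLevel ϖ ℓ (Matrix.diagonal e) (latt (!![1, 0, 0; x, ϖ ^ ρ, 0; x * ζ + y'', ϖ ^ ρ * ζ, ϖ ^ (2 * ρ + s)] : Matrix (Fin 3) (Fin 3) K)) ↔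
      (Valued.v (e 0) ≤ Valued.v ϖ ^ ℓ ∧ Valued.v (e 1) ≤ Valued.v ϖ ^ ℓ ∧ Valued.v (e 2) ≤ Valued.v ϖ ^ ℓ) ∧
        Valued.v (e 1 - e 0) ≤ Valued.v ϖ ^ (ℓ + ρ) ∧ Valued.v (e 2 - e 1) ≤ Valued.v ϖ ^ (ℓ + ρ + s) ∧
          Valued.v (x * ζ * (e 2 - e 1) + (e 2 - e 0) * y'') ≤ Valued.v ϖ ^ (ℓ + 2 * ρ + s) := by
  have hϖρ : (ϖ ^ ρ : K) ≠ 0 := pow_ne_zero ρ hϖ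
  have hvϖ : 0 < Valued.v ϖ := (Valuation.pos_iff _).2 hϖ
  have hform : (!![1, 0, 0; x, ϖ ^ ρ, 0; x * ζ + y'', ϖ ^ ρ * ζ, ϖ ^ (2 * ρ + s)] : Matrix (Fin 3) (Fin 3) K) =
      Matrix.of ![![1, 0, 0], ![x, ϖ ^ ρ, 0], ![x * ζ + y'', ϖ ^ ρ * ζ, ϖ ^ (2 * ρ + s)]] := rfl
  rw [hform, latticeInLevel_diagonal_latt_hnf_pow_iff hϖ ℓ ρ (2 * ρ + s) e x (x * ζ + y'') (ϖ ^ ρ * ζ)]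
  -- the three mixed entries, one by one
  have e1 : Valued.v ((e 1 - e 0) * x) ≤ Valued.v ϖ ^ (ℓ + ρ) ↔ Valued.v (e 1 - e 0) ≤ Valued.v ϖ ^ (ℓ + ρ) := by
    rw [map_mul, hx, mul_one]
  have e2 : Valued.v ((e 2 - e 1) * (ϖ ^ ρ * ζ)) ≤ Valued.v ϖ ^ (ℓ + (2 * ρ + s)) ↔ Valued.v (e 2 - e 1) ≤ Valued.v ϖ ^ (ℓ + ρ + s) := by
    rw [show (e 2 - e 1) * (ϖ ^ ρ * ζ) = (e 2 - e 1) * ζ * ϖ ^ ρ by ring,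
      show Valued.v ϖ ^ (ℓ + (2 * ρ + s)) = Valued.v (ϖ ^ (ℓ + ρ + s) * ϖ ^ ρ) by rw [← pow_add, map_pow]; congr 1; ring,
      v_mul_le_mul_iff_of_ne_zero hϖρ, map_mul, hζ, mul_one, map_pow]
  have e3 : Valued.v ((e 2 - e 0) * (x * ζ + y'') * ϖ ^ ρ + (e 0 - e 1) * x * (ϖ ^ ρ * ζ)) ≤ Valued.v ϖ ^ (ℓ + ρ + (2 * ρ + s)) ↔
      Valued.v (x * ζ * (e 2 - e 1) + (e 2 - e 0) * y'') ≤ Valued.v ϖ ^ (ℓ + 2 * ρ + s) := by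
    rw [show (e 2 - e 0) * (x * ζ + y'') * ϖ ^ ρ + (e 0 - e 1) * x * (ϖ ^ ρ * ζ) = (x * ζ * (e 2 - e 1) + (e 2 - e 0) * y'') * ϖ ^ ρ by ring,
      show Valued.v ϖ ^ (ℓ + ρ + (2 * ρ + s)) = Valued.v (ϖ ^ (ℓ + 2 * ρ + s) * ϖ ^ ρ) by rw [← pow_add, map_pow]; congr 1; ring,
      v_mul_le_mul_iff_of_ne_zero hϖρ, map_pow]
  rw [e1, e2, e3]
  simp only [and_assoc]

end Read

/-! ## §2  Off the cancellation locus the mixed inequality splits, so the token is constant on the stratum -/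

section Constant

variable {K : Type*} [Field K] [Valued K ℤᵐ⁰]

/-- **ULTRAMETRIC EQUALITY CASE**: if `|a| ≠ |b|` then `|a + b| ≤ c ↔ |a| ≤ c ∧ |b| ≤ c` (`|a + b| = max |a| |b|`). [cite: Serre1980Trees, II §1.1] -/
theorem v_add_le_iff_of_v_ne {a b : K} (h : Valued.v a ≠ Valued.v b) (c : ℤᵐ⁰) :
    Valued.v (a + b) ≤ c ↔ Valued.v a ≤ c ∧ Valued.v b ≤ c := by
  rw [Valuation.map_add_of_distinct_val _ h, max_le_iff]

/-- **CONSTANCY OFF THE LOCUS**: if `|e₂ − e₁| ≠ |e₂ − e₀|·|ϖ|^s` (`|y″| = |ϖ|^s`), the token on the G1 normal form does not see `x, ζ, y″`: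
`diag(e)·M ⊆ ϖ^ℓ·M ↔ (∀ i, |e_i| ≤ |ϖ|^ℓ) ∧ |e₁ − e₀| ≤ |ϖ|^{ℓ+ρ} ∧ |e₂ − e₁| ≤ |ϖ|^{ℓ+ρ+s} ∧ |e₂ − e₁| ≤ |ϖ|^{ℓ+2ρ+s} ∧ |e₂ − e₀|·|ϖ|^s ≤ |ϖ|^{ℓ+2ρ+s}`.
[cite: Serre1980Trees, II §1.1] [cite: Kottwitz1986BaseChangeUnits, §1 pp. 240–241] -/
theorem latticeInLevel_diagonal_latt_G1_iff_of_ne {ϖ : K} (hϖ : ϖ ≠ 0) (ℓ ρ s : ℕ) (e : Fin 3 → K) {x ζ y'' : K} (hx : Valued.v x = 1) (hζ : Valued.v ζ = 1)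
    (hy : Valued.v y'' = Valued.v ϖ ^ s) (hne : Valued.v (e 2 - e 1) ≠ Valued.v (e 2 - e 0) * Valued.v ϖ ^ s) :
    LatticeInLevel ϖ ℓ (Matrix.diagonal e) (latt (!![1, 0, 0; x, ϖ ^ ρ, 0; x * ζ + y'', ϖ ^ ρ * ζ, ϖ ^ (2 * ρ + s)] : Matrix (Fin 3) (Fin 3) K)) ↔
      (Valued.v (e 0) ≤ Valued.v ϖ ^ ℓ ∧ Valued.v (e 1) ≤ Valued.v ϖ ^ ℓ ∧ Valued.v (e 2) ≤ Valued.v ϖ ^ ℓ) ∧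
        Valued.v (e 1 - e 0) ≤ Valued.v ϖ ^ (ℓ + ρ) ∧ Valued.v (e 2 - e 1) ≤ Valued.v ϖ ^ (ℓ + ρ + s) ∧
          (Valued.v (e 2 - e 1) ≤ Valued.v ϖ ^ (ℓ + 2 * ρ + s) ∧ Valued.v (e 2 - e 0) * Valued.v ϖ ^ s ≤ Valued.v ϖ ^ (ℓ + 2 * ρ + s)) := by
  have h1 : Valued.v (x * ζ * (e 2 - e 1)) = Valued.v (e 2 - e 1) := by rw [map_mul, map_mul, hx, hζ, one_mul, one_mul]
  have h2 : Valued.v ((e 2 - e 0) * y'') = Valued.v (e 2 - e 0) * Valued.v ϖ ^ s := by rw [map_mul, hy]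
  have hne' : Valued.v (x * ζ * (e 2 - e 1)) ≠ Valued.v ((e 2 - e 0) * y'') := by rwa [h1, h2]
  rw [latticeInLevel_diagonal_latt_G1_iff hϖ ℓ ρ s e hx hζ y'', v_add_le_iff_of_v_ne hne', h1, h2]

end Constant

/-! ## §3  HEAD — the labelled G1 eighth off the cancellation locus, over ★ B56 -/

section Table

variable {K : Type} [Field K] [Valued K ℤᵐ⁰] [Fintype 𝓀[K]] {σ : K →+* K} {ϖ : K} {d t : ℕ} {α β : K} {N₀ n₁ n₂ n₃ : ℕ} {T : GL (Fin 3) K}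

/-- **LABELLED G1 `(2ρ, 2ρ+s, 2ρ+s)` OFF THE CANCELLATION LOCUS** (`ρ, s ≥ 1`; `|e₂ − e₁| ≠ |e₂ − e₀|·|ϖ|^s`): the label-cut weight sum over the glued stratum is ★ B56's
value behind the constant indicator of §2 — `Σᶠ_{M ∈ stratum (2ρ,2ρ+s,2ρ+s), diag(e)M ⊆ ϖ^ℓM} stabiliserWeight σ M = [P(e, ℓ, ρ, s)] · ★ finsum_stabiliserWeight_hasAxis_G1`.  For the
operators of record `e = (α−1, β−1, 0)` the hypothesis `hne` reads `n₁ ≠ n₂ + s` — i.e. OFF ★ B56's foot regime; on the foot the token cuts the stratum by the residue of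
`xζ(e₂−e₁) + (e₂−e₀)y″` and the sub-census is the producer's target. [cite: Rogawski1990, §4.9 Prop. 4.9.1 (a) p. 55] [cite: Kottwitz1986BaseChangeUnits, §1 pp. 240–241] -/
theorem finsum_stabiliserWeight_stratum_G1_sep_latticeInLevel_of_ne (hD : IsRamifiedQuadraticDatum σ ϖ d t) (h2 : Valued.v (2 : K) < 1)
    (hE : IsElementDatum σ ϖ N₀ α β n₁ n₂ n₃) (hN₀ : d ≤ N₀) (hT : (T : Matrix (Fin 3) (Fin 3) K) = Matrix.diagonal ![α, β, 1])
    (ρ s : ℕ) (hρ : 1 ≤ ρ) (hs : 1 ≤ s) (ℓ : ℕ) (e : Fin 3 → K) (hne : Valued.v (e 2 - e 1) ≠ Valued.v (e 2 - e 0) * Valued.v ϖ ^ s) :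
    ∑ᶠ M ∈ {M | M ∈ stratum σ ϖ T ![2 * ρ, 2 * ρ + s, 2 * ρ + s] ∧ LatticeInLevel ϖ ℓ (Matrix.diagonal e) M}, stabiliserWeight σ M =
      if ((Valued.v (e 0) ≤ Valued.v ϖ ^ ℓ ∧ Valued.v (e 1) ≤ Valued.v ϖ ^ ℓ ∧ Valued.v (e 2) ≤ Valued.v ϖ ^ ℓ) ∧
          Valued.v (e 1 - e 0) ≤ Valued.v ϖ ^ (ℓ + ρ) ∧ Valued.v (e 2 - e 1) ≤ Valued.v ϖ ^ (ℓ + ρ + s) ∧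
            (Valued.v (e 2 - e 1) ≤ Valued.v ϖ ^ (ℓ + 2 * ρ + s) ∧ Valued.v (e 2 - e 0) * Valued.v ϖ ^ s ≤ Valued.v ϖ ^ (ℓ + 2 * ρ + s))) then
        ((if 2 ∣ s ∧ 2 * ρ ≤ min n₂ n₃ ∧ 2 * ρ + s ≤ n₁ then (((Fintype.card 𝓀[K] : ℚ) - 1) * (Fintype.card 𝓀[K] : ℚ) ^ (2 * ρ + s / 2 - 1)) else 0) +
          (if 2 ∣ s ∧ n₂ = n₃ ∧ n₁ = n₂ + s ∧ n₂ < 2 * ρ ∧ 2 * ρ - n₂ ≤ n₂ - d + 1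
            then ((Fintype.card 𝓀[K] : ℚ) ^ (2 * ρ + s / 2 - (2 * ρ - n₂ + 1) / 2)) else 0))
      else 0 := by
  classical
  have hvσ : ∀ a, Valued.v (σ a) = Valued.v a := hD.2.1
  have hϖ : Valued.v ϖ = WithZero.exp (-1 : ℤ) := hD.2.2.1
  have hfix : ∀ x : K, σ x = x → x ≠ 0 → ∃ n : ℤ, Valued.v x = WithZero.exp (2 * n) := hD.2.2.2.1
  have hϖ0 : ϖ ≠ 0 := fun h0 => by rw [h0, map_zero] at hϖ; exact WithZero.coe_ne_zero hϖ.symm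
  rw [finsum_mem_sep_eq_ite_of_forall_iff (stratum σ ϖ T ![2 * ρ, 2 * ρ + s, 2 * ρ + s]) _ _ (fun M hM => by
    rw [stratum_G1_eq hvσ hfix hϖ T hρ hs] at hM
    obtain ⟨x, ζ, y'', hx, hζ, hy, rfl, -, -⟩ := hM
    exact latticeInLevel_diagonal_latt_G1_iff_of_ne hϖ0 ℓ ρ s e hx hζ hy hne), finsum_stabiliserWeight_hasAxis_G1 hD h2 hE hN₀ hT ρ s hρ hs]

end Table

end Summit.HodgeConjecture.HodgeConjecture.Cruxes.H413.F0P3cDyRamLabelledGluedStratumRead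

end
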